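import Summits.CriticalPhenomena.PercolationContinuityZ3.Theorems.PercNearOneGluingNoHeavyQuantSliceLamColumnsBudget
import Summits.CriticalPhenomena.PercolationContinuityZ3.Theorems.PercNearOneGluingNoHeavyQuantSliceLamColumnsPairs
import Summits.CriticalPhenomena.PercolationContinuityZ3.Theorems.PercNearOneGluingNoHeavyQuantSliceDeepShallowLows
import Summits.CriticalPhenomena.PercolationContinuityZ3.Theorems.PercNearOneGluingNoHeavyQuantSliceMidsBelow
import Summits.CriticalPhenomena.PercolationContinuityZ3.Theorems.PercNearOneGluingNoHeavyQuantSliceConeForm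
import HarnessLib

/-!
# QUANT lane R8, T-DEC: **THEOREM E — SL-λ* FOR EVERY SUPPORT AT `g ≥ 1/2`, MODULO THE LOCAL BAND PIECE** (LEAD-NOTES-G23 N52)

builds on p205010 (kernel theorem, internal audit signed; external expert review pending)

Support file (`--supports stmt-CriticalPhenomena-4575`), QUANT lane lead seat prim-quant-lead (gen 23), rung R8 of
`run/shared/lean/prim/quant/LADDER.md`.  One theorem; standard axioms, no sorries.  Parts 1–2: `…QuantSliceLamColumnsBudget` (`lamFlow`,
`pool_budget_lamColumns`), `…QuantSliceLamColumnsPairs` (`subflowLaw_eq_mixture`, `bvalidAt_cornerPair`); uses Theorem A⁺'s core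
(`slice_isFlowAtT_of_deepShallowLows_core`, `…QuantSliceDeepShallowLows`), the sub-flow calculus (`…QuantFlowSplit`), the corner witness
and identity (`…QuantCornerWitness`, `…QuantCornerLayerRestrict`), the typer's `slice_decAtT_of_bdecAtT'` and census-2's
`decAtT_finite_mixture`.

**`slice_decAtT_of_lamColumns`**: probability law `ν` on `{0..M}`, `0 < x < 1`, `1 ≤ a ≤ j′`, `x ≤ g ≤ 1`, `1/2 ≤ g`, `λ ≤ j′ ≤ λ + a`,
charged non-lows `k ≤ λ` band-like at `T′ = T + ag` or with `k + a ≤ j′`, charged atoms in `(λ, j′]` true mids at `T′` — for `λ = λ*`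
(least charged true window mid − 1, or `j′`) these two support conditions hold for EVERY law — and the BAND PIECE for the law's charged cheap
band pairs (`hband`).  THEN `DECAtT x T j′ M ν ∧ DECAtT x T λ M ν ⟹ DECAtT x T′ j′ (M + a) (slice ν a g)`.
Companion `…QuantSliceLamStar`: THEOREM E* `slice_decAtT_of_bandTwoBlobDEC` (the band hypothesis discharged from the typer's
`@[conjecture] LawDec.BandTwoBlobDEC`, conditional) and SL-λ* at `g ≥ 1/2` in the conjecture's own form.  Far pairs (`j′ < l + a`) need
nothing (`slice_farPair_decAtT`, census-2).
CONSEQUENCE (README V269): at every floor `x ≥ 1/2`, CONJECTURE SL-λ* (V253) — hence `LawDec.SliceClosedAll` restricted to `g ≥ 1/2` along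
the two-layer route — FOLLOWS from the local band piece by a kernel-checked implication, with no further global argument.  The case
`g < 1/2` and the band piece itself remain OPEN here.

[this work]; nothing here is cited as a published result.  The gluing rows served [cite: KozmaNitzan2024, Conjecture 3 (p. 15)]; product
measure [cite: Grimmett1999, §1.3 p. 10].
-/

noncomputable section

namespace Summit.CriticalPhenomena.PercolationContinuityZ3.Theorems

namespace Quant

open Finset

/-- the two-point law `{lo, hi; g}` (as in `…QuantLawDEC`) -/
local notation3 "TP[" lo ", " hi ", " g ", " h "]" =>
  (g : ℝ) * (if (h : ℕ) = (hi : ℕ) then (1 : ℝ) else 0) + (1 - (g : ℝ)) * (if (h : ℕ) = (lo : ℕ) then (1 : ℝ) else 0)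

namespace LawDec

/-! ### Theorem E (LEAD-NOTES-G23 N52) -/

section LamColumnsMain

variable (x T g : ℝ) (j' M a lam : ℕ) (ν : ℕ → ℝ)

/-- **THEOREM E (lead g23, N52): SL-λ FOR EVERY SUPPORT AT `g ≥ 1/2`, MODULO THE LOCAL BAND PIECE.**  Probability law `ν` on `{0..M}`,
`0 < x < 1`, `1 ≤ a ≤ j′`, `x ≤ g ≤ 1`, `1/2 ≤ g`, `λ ≤ j′ ≤ λ + a`; SUPPORT (automatic for `λ = λ*`, the least true window mid − 1): every
charged non-low `k ≤ λ` is band-like at `T′ = T + a·g` (`2k ≤ T′`) or has `k + a ≤ j′`, and every charged atom in `(λ, j′]` is a true mid at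
`T′`; HYPOTHESIS `hband` (the BAND PIECE — census-1 g19 SLAMSTAR-G19 §2, typer g24 `LawDec.BandTwoBlobDEC`): for every charged CHEAP BAND
PAIR of the law — `l < h ≤ λ`, `l + a ≤ j′ < h + a`, `2l < T < l + h`, `2h ≤ T′`, `pairGate x T l h < x`, `ν l ≠ 0 ≠ ν h` — the slice
of the two-point law `{l, h; pairGate x T l h}` is `DECAtT x T′ j′ (M + a)` (pairs with `j′ < l + a` are far pairs, `slice_farPair_decAtT`).  THEN `DECAtT x T j′ M ν ∧ DECAtT x T λ M ν ⟹
DECAtT x T′ j′ (M + a) (slice ν a g)`.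
PROOF: corner witness at `j′`; ALL its columns `h ≤ λ` (`lamFlow`; they contain the `M_b` columns and, by the corner identity, agree with
the `λ`-run) are split off (`…QuantFlowSplit`) and written as the mixture of their corner pairs (`subflowLaw_eq_mixture`); a pair that is
heavy or has `h + a ≤ j′` is `BDECAtT` (`bvalidAt_cornerPair`) and slices by the typer's `slice_decAtT_of_bdecAtT'`, a cheap pair with
`h + a > j′` is band-like by the support hypothesis and slices by `hband`; the residual datum slices by Theorem A⁺'s core with the pool
budget `pool_budget_lamColumns` (its low hypothesis is implied by the window hypothesis, as in Theorem D′); the slices recombine by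
`decAtT_finite_mixture`.  Contains Theorems A, A⁺, C, D, D′. [this work] -/
theorem slice_decAtT_of_lamColumns (hx0 : 0 < x) (hx1 : x < 1) (hxg : x ≤ g) (hg1 : g ≤ 1) (hg2 : 1 / 2 ≤ g)
    (ha : 1 ≤ a) (haj : a ≤ j') (hν : ∀ k, 0 ≤ ν k) (hνM : ∀ k, M < k → ν k = 0)
    (hν1 : ∑ h ∈ Finset.range (M + 1), ν h = 1)
    (hdj : DECAtT x T j' M ν) (hdl : DECAtT x T lam M ν) (hlamj : lam ≤ j') (hlam : j' ≤ lam + a)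
    (hbelow : ∀ k, k ≤ lam → T ≤ 2 * (k : ℝ) → ν k ≠ 0 → 2 * (k : ℝ) ≤ T + (a : ℝ) * g ∨ k + a ≤ j')
    (habove : ∀ k, lam < k → k ≤ j' → ν k ≠ 0 → T + (a : ℝ) * g < 2 * (k : ℝ))
    (hband : ∀ l h : ℕ, l < h → h ≤ lam → l + a ≤ j' → 2 * (l : ℝ) < T → T < (l : ℝ) + h → 2 * (h : ℝ) ≤ T + (a : ℝ) * g →
      j' < h + a → pairGate x T l h < x → ν l ≠ 0 → ν h ≠ 0 →
      DECAtT x (T + (a : ℝ) * g) j' (M + a) (slice (fun k => TP[l, h, pairGate x T l h, k]) a g)) :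
    DECAtT x (T + (a : ℝ) * g) j' (M + a) (slice ν a g) := by
  classical
  have hg0 : 0 ≤ g := hx0.le.trans hxg
  have hag : 0 ≤ (a : ℝ) * g := mul_nonneg (Nat.cast_nonneg a) hg0
  -- the low hypothesis of the budget is implied by the window hypothesis (as in Theorem D′)
  have hlows : ∀ k, k ≤ j' → 2 * (k : ℝ) < T → ν k ≠ 0 →
      (2 * ((k : ℝ) + a) < T + (a : ℝ) * g ∧ k + a ≤ j') ∨ ((T + (a : ℝ) * g ≤ 2 * ((k : ℝ) + a) ∨ j' < k + a) ∧ k ≤ lam) := by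
    intro k hk hlow hne
    by_cases hd : 2 * ((k : ℝ) + a) < T + (a : ℝ) * g ∧ k + a ≤ j'
    · exact Or.inl hd
    · refine Or.inr ⟨?_, ?_⟩
      · rcases not_and_or.1 hd with h1 | h1
        · exact Or.inl (not_lt.1 h1)
        · exact Or.inr (not_le.1 h1)
      · by_contra hkl
        have := habove k (not_le.1 hkl) hk hne
        linarith
  -- corner certificates at the two layers
  have hCj : CornerSucceeds x T j' M ν :=
    (flowAtT_iff_cornerSucceeds x T j' M ν hx0 hx1 hν).1 (flowAtT_of_decAtT x T j' M ν hx0 hx1 hdj)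
  have hCl : CornerSucceeds x T lam M ν :=
    (flowAtT_iff_cornerSucceeds x T lam M ν hx0 hx1 hν).1 (flowAtT_of_decAtT x T lam M ν hx0 hx1 hdl)
  obtain ⟨hV0, -, hrow, -⟩ := cornerFlow_inv x T j' M ν hx0 hx1 hν ((j' + 1) * (j' + 1)) le_rfl
  set fB := lamFlow x T j' M lam ν with hfB
  set νR := lamResidual x T j' M lam ν with hνRdef
  set fR := lamResidualFlow x T j' M lam ν with hfRdef
  have hW := isFlowAtT_cornerWitness x T j' M ν hx0 hx1 hν hCj
  have hB0 : ∀ l h, 0 ≤ fB l h := fun l h => (lamFlow_nonneg_le x T j' M lam ν hx0 hx1 hν hCj hlamj l h).1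
  have hBle : ∀ l h, fB l h ≤ cornerWitness x T j' M ν l h :=
    fun l h => (lamFlow_nonneg_le x T j' M lam ν hx0 hx1 hν hCj hlamj l h).2
  have hR : IsFlowAtT x T j' M νR fR := isFlowAtT_residual_of_subflow x T j' M ν _ fB hx0 hx1 hW hB0 hBle
  have hνR0 : ∀ k, 0 ≤ νR k := residual_nonneg_of_subflow x T j' M ν _ fB hx0 hx1 hνM hW hB0 hBle
  have hsub0 : ∀ k, 0 ≤ subflowLaw x T j' M fB k := subflowLaw_nonneg x T j' M ν _ fB hx0 hx1 hW hB0 hBle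
  have hνRle : ∀ k, νR k ≤ ν k := fun k => by
    show ν k - subflowLaw x T j' M fB k ≤ ν k; linarith [hsub0 k]
  have eR : ∀ k, νR k = ν k - subflowLaw x T j' M fB k := fun k => rfl
  have hsuble : ∀ k, subflowLaw x T j' M fB k ≤ ν k := fun k => by linarith [hνR0 k, eR k]
  have hνRM : ∀ k, M < k → νR k = 0 := fun k hk => le_antisymm (by linarith [hνRle k, hνM k hk]) (hνR0 k)
  have hsubM : ∀ k, M < k → subflowLaw x T j' M fB k = 0 := fun k hk => le_antisymm (by linarith [hsuble k, hνM k hk]) (hsub0 k)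
  have hneR : ∀ k, νR k ≠ 0 → ν k ≠ 0 := fun k hk hz => hk (le_antisymm (by linarith [hνRle k]) (hνR0 k))
  have hlowsR : ∀ k, k ≤ j' → 2 * (k : ℝ) < T → νR k ≠ 0 →
      (2 * ((k : ℝ) + a) < T + (a : ℝ) * g ∧ k + a ≤ j') ∨ ((T + (a : ℝ) * g ≤ 2 * ((k : ℝ) + a) ∨ j' < k + a) ∧ k ≤ lam) :=
    fun k hk hlow hne => hlows k hk hlow (hneR k hne)
  have haboveR : ∀ k, lam < k → k ≤ j' → νR k ≠ 0 → T + (a : ℝ) * g < 2 * (k : ℝ) :=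
    fun k hk hkj hne => habove k hk hkj (hneR k hne)
  -- every charged column is a mid `≤ λ ≤ j′`
  have hBmid : ∀ l h, 0 < fB l h → h ≤ j' := fun l h hp => (lamFlow_pos x T j' M lam ν hx0 hx1 hν l h hp).1.trans hlamj
  -- the residual datum sliced by Theorem A⁺'s core
  have hPB := pool_budget_lamColumns x T g j' M a lam ν hx0 hx1 hg0 hg1 hg2 hν hνM hlamj hCj hCl hlows habove
  have hcore := slice_isFlowAtT_of_deepShallowLows_core x T g j' M a lam νR fR hx0 hx1 hxg hg1 ha haj hνR0 hνRM hR hlamj hlam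
    hlowsR haboveR hPB
  -- masses
  set c := ∑ l ∈ Finset.range (j' + 1), ∑ h ∈ Finset.range (M + 1), fB l h / (1 - pairGate x T l h) with hcdef
  have hmassB : ∑ k ∈ Finset.range (M + 1), subflowLaw x T j' M fB k = c :=
    subflowLaw_mass x T j' M ν _ fB hx0 hx1 hνM hW hB0 hBle hBmid
  have hmassR : ∑ k ∈ Finset.range (M + 1), νR k = 1 - c := by
    have : ∑ k ∈ Finset.range (M + 1), νR k = ∑ k ∈ Finset.range (M + 1), ν k - ∑ k ∈ Finset.range (M + 1), subflowLaw x T j' M fB k := by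
      rw [← Finset.sum_sub_distrib]; exact Finset.sum_congr rfl fun k _ => eR k
    rw [this, hν1, hmassB]
  have hc0 : 0 ≤ c := by rw [← hmassB]; exact Finset.sum_nonneg fun k _ => hsub0 k
  have hc1 : c ≤ 1 := by
    have : 0 ≤ ∑ k ∈ Finset.range (M + 1), νR k := Finset.sum_nonneg fun k _ => hνR0 k
    linarith
  -- degenerate masses: a nonnegative law of mass 0 vanishes
  have hsubz : c = 0 → ∀ k, subflowLaw x T j' M fB k = 0 := by
    intro hc k
    by_cases hk : k ≤ M
    · have := (Finset.sum_eq_zero_iff_of_nonneg (fun k _ => hsub0 k)).1 (hmassB.trans hc) k (Finset.mem_range.2 (by omega))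
      exact this
    · exact hsubM k (by omega)
  have hνRz : c = 1 → ∀ k, νR k = 0 := by
    intro hc k
    by_cases hk : k ≤ M
    · have h0 : ∑ k ∈ Finset.range (M + 1), νR k = 0 := by rw [hmassR, hc]; ring
      exact (Finset.sum_eq_zero_iff_of_nonneg (fun k _ => hνR0 k)).1 h0 k (Finset.mem_range.2 (by omega))
    · exact hνRM k (by omega)
  -- the two normalised slices
  set μ₁ : ℕ → ℝ := slice (fun k => subflowLaw x T j' M fB k / c) a g with hμ₁
  set μ₂ : ℕ → ℝ := slice (fun k => νR k / (1 - c)) a g with hμ₂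
  have hmix : ∀ h, slice ν a g h = c * μ₁ h + (1 - c) * μ₂ h := by
    intro h
    have eν : ν = fun k => 1 * subflowLaw x T j' M fB k + 1 * νR k := by
      funext k; show ν k = 1 * subflowLaw x T j' M fB k + 1 * (ν k - subflowLaw x T j' M fB k); ring
    have e1 : c * μ₁ h = slice (fun k => subflowLaw x T j' M fB k) a g h := by
      by_cases hc : c = 0
      · have hz := hsubz hc
        simp only [hμ₁, slice, hz, hc]; simp
      · simp only [hμ₁, slice]
        split_ifs
        · field_simp
        · simp only [mul_zero, add_zero]; field_simp
    have e2 : (1 - c) * μ₂ h = slice (fun k => νR k) a g h := by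
      by_cases hc : c = 1
      · have hz := hνRz hc
        simp only [hμ₂, slice, hz, hc]; simp
      · have hne : (1:ℝ) - c ≠ 0 := sub_ne_zero.2 (Ne.symm hc)
        simp only [hμ₂, slice]
        split_ifs
        · field_simp
        · simp only [mul_zero, add_zero]; field_simp
    rw [e1, e2, eν, slice_linear]; ring
  refine decAtT_finite_mixture x (T + (a : ℝ) * g) j' (M + a) (slice ν a g) (fun b : Bool => if b then c else 1 - c)
    (fun b => if b then μ₁ else μ₂) (fun b => by cases b <;> simp [hc0, hc1]) (by simp)
    (fun h => by simp [hmix h]) ?_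
  intro b hb
  cases b with
  | true =>
    -- the removed columns: the mixture of their corner pairs, sliced pair by pair
    rw [if_pos rfl] at hb ⊢
    set w : Fin (j' + 1) × Fin (M + 1) → ℝ := fun r => fB r.1 r.2 / ((1 - pairGate x T r.1 r.2) * c) with hw
    set P : Fin (j' + 1) × Fin (M + 1) → ℕ → ℝ := fun r k => TP[(r.1 : ℕ), (r.2 : ℕ), pairGate x T r.1 r.2, k] with hP
    have eμ₁ : μ₁ = slice (fun k => ∑ r, w r * P r k) a g := by
      simp only [hμ₁]
      congr 1
      funext k
      exact subflowLaw_eq_mixture x T j' M ν _ fB hx0 hx1 hνM hW hB0 hBle hBmid c hb k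
    -- facts about charged pairs
    have ch : ∀ l h, 0 < fB l h → h ≤ lam ∧ l ≤ j' ∧ 2 * (l : ℝ) < T ∧ h ≤ M ∧ T < (l : ℝ) + h ∧ 0 < ν h ∧ l < h ∧
        0 < pairGate x T l h ∧ pairGate x T l h < 1 ∧ 0 < ν l := by
      intro l h hp
      obtain ⟨hhl, hl, hlow, hhM, hcomp, hνh⟩ := lamFlow_pos x T j' M lam ν hx0 hx1 hν l h hp
      have hlh : l < h := by
        have : (l : ℝ) < h := by linarith
        exact_mod_cast this
      refine ⟨hhl, hl, hlow, hhM, hcomp, hνh, hlh, pairGate_pos x T l h hlow hlh, pairGate_lt_one x T l h hx0 hx1 hlow hcomp, ?_⟩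
      -- the low of a charged corner pair is charged: the row ships at most `ν l`
      have hrowl := hrow l
      have hle : cornerMidFlow x T j' M ν l h ≤ ∑ h' ∈ Finset.range (M + 1), cornerMidFlow x T j' M ν l h' :=
        Finset.single_le_sum (f := fun h' => cornerMidFlow x T j' M ν l h') (fun h' _ => hV0 l h') (Finset.mem_range.2 (by omega))
      have hp' : 0 < cornerMidFlow x T j' M ν l h := by
        have := hBle l h
        rw [cornerWitness_of_le x T j' M ν l h (by omega)] at this
        exact lt_of_lt_of_le hp this
      unfold cornerMidFlow at hle hp' hrowl
      linarith
    have hw0 : ∀ r, 0 ≤ w r := by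
      intro r
      show 0 ≤ fB r.1 r.2 / ((1 - pairGate x T r.1 r.2) * c)
      rcases (hB0 r.1 r.2).eq_or_lt with hz | hp
      · rw [← hz, zero_div]
      · obtain ⟨-, -, -, -, -, -, -, -, hγ1, -⟩ := ch r.1 r.2 hp
        exact div_nonneg hp.le (mul_nonneg (by linarith) hb.le)
    have hw1 : ∑ r, w r = 1 := by
      show ∑ r : Fin (j' + 1) × Fin (M + 1), fB r.1 r.2 / ((1 - pairGate x T r.1 r.2) * c) = 1
      have conv : ∑ r : Fin (j' + 1) × Fin (M + 1), fB r.1 r.2 / ((1 - pairGate x T r.1 r.2) * c)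
          = ∑ l ∈ Finset.range (j' + 1), ∑ h ∈ Finset.range (M + 1), fB l h / ((1 - pairGate x T l h) * c) := by
        rw [Fintype.sum_prod_type, ← Fin.sum_univ_eq_sum_range
          (fun l => ∑ h ∈ Finset.range (M + 1), fB l h / ((1 - pairGate x T l h) * c)) (j' + 1)]
        refine Fintype.sum_congr _ _ fun i => ?_
        exact Fin.sum_univ_eq_sum_range (fun h => fB i h / ((1 - pairGate x T i h) * c)) (M + 1)
      rw [conv]
      have e : ∀ l h, fB l h / ((1 - pairGate x T l h) * c) = (fB l h / (1 - pairGate x T l h)) / c := fun l h => by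
        rw [div_div]
      simp only [e, ← Finset.sum_div]
      rw [← hcdef, div_self hb.ne']
    rw [eμ₁]
    refine decAtT_finite_mixture x (T + (a : ℝ) * g) j' (M + a) _ w (fun r => slice (P r) a g) hw0 hw1
      (fun h => slice_fintype_sum w P a g h) ?_
    intro r hr
    have hp : 0 < fB r.1 r.2 := by
      by_contra hnp
      have hz : fB r.1 r.2 = 0 := le_antisymm (not_lt.1 hnp) (hB0 _ _)
      have : w r = 0 := by show fB r.1 r.2 / ((1 - pairGate x T r.1 r.2) * c) = 0; rw [hz, zero_div]
      rw [this] at hr; exact lt_irrefl _ hr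
    obtain ⟨hhl, -, hlow, hhM, hcomp, hνh, hlh, hγ0, hγ1, hνl⟩ := ch r.1 r.2 hp
    show DECAtT x (T + (a : ℝ) * g) j' (M + a) (slice (fun k => TP[(r.1 : ℕ), (r.2 : ℕ), pairGate x T r.1 r.2, k]) a g)
    by_cases hcase : (r.2 : ℕ) + a ≤ j' ∨ x ≤ pairGate x T r.1 r.2
    · -- heavy, or below the layer after the shift: no light straddler
      exact slice_decAtT_of_bdecAtT' x T g j' M a _ hx0 hx1 hxg hg1 ha
        (bdecAtT_single x T j' M a r.1 r.2 _ ⟨hγ0.le, hγ1.le⟩ hlh.le hhM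
          (bvalidAt_cornerPair x T j' a r.1 r.2 hx0 hx1 hlow hlh (hhl.trans hlamj) hcase))
    · -- a cheap pair whose column has a giant copy: band-like by the support hypothesis; the BAND PIECE
      rcases not_or.1 hcase with ⟨hfar, hcheap⟩
      have h2h : T ≤ 2 * ((r.2 : ℕ) : ℝ) := by
        have : ((r.1 : ℕ) : ℝ) < (r.2 : ℕ) := by exact_mod_cast hlh
        linarith
      have hband2 : 2 * ((r.2 : ℕ) : ℝ) ≤ T + (a : ℝ) * g := by
        rcases hbelow r.2 hhl h2h hνh.ne' with h | h
        · exact h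
        · exact absurd h hfar
      by_cases hfl : j' + 1 ≤ (r.1 : ℕ) + a
      · -- the low's shifted copy is a giant: far pair, sliceable at any target
        exact slice_farPair_decAtT x _ g _ j' M r.1 r.2 a hxg hg0 hg1 ⟨hγ0.le, hγ1.le⟩ ha hlh.le hhM hfl
      · exact hband r.1 r.2 hlh hhl (by omega) hlow hcomp hband2 (not_le.1 hfar) (not_le.1 hcheap) hνl.ne' hνh.ne'
  | false =>
    rw [if_neg Bool.false_ne_true] at hb ⊢
    have hb' : 0 < 1 - c := hb
    -- scale the residual witness to mass one
    have hsc := hcore.smul (1 / (1 - c)) (div_nonneg zero_le_one hb'.le)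
    have eμ : (fun k => 1 / (1 - c) * slice νR a g k) = μ₂ := by
      funext k; simp only [hμ₂]; unfold slice
      split_ifs
      · field_simp
      · simp only [mul_zero, add_zero]; field_simp
    rw [eμ] at hsc
    have hflow : FlowAtT x (T + (a : ℝ) * g) j' (M + a) μ₂ := ⟨_, hsc⟩
    have hμ₂M : ∀ h, M + a < h → μ₂ h = 0 := fun h hh => by
      simp only [hμ₂]; exact slice_eq_zero _ a g M (fun k hk => by rw [hνRM k hk, zero_div]) h hh
    have hμ₂1 : ∑ h ∈ Finset.range (M + a + 1), μ₂ h = 1 := by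
      simp only [hμ₂]
      refine sum_slice _ a g M (fun k hk => by rw [hνRM k hk, zero_div]) ?_
      rw [← Finset.sum_div, hmassR, div_self hb'.ne']
    exact decAtT_of_flowAtT x _ j' (M + a) μ₂ hx0 hx1 hμ₂M hμ₂1 hflow

end LamColumnsMain

end LawDec

end Quant

end Summit.CriticalPhenomena.PercolationContinuityZ3.Theorems
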